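import Summits.Ventures.DiscreteObjects.Hadamard.Order167WilliamsonSymmetric668
import Literature.Combinatorics.Designs.WilliamsonArray

/-!
# H(668): maximal local symmetry at 167 ⇔ WILLIAMSON SEQUENCES of length 167 — the kernel iff of gen 22 read in the
# language of Williamson's 1944 construction (`Literature.Combinatorics.Designs.WilliamsonArray`)

Framing: lottery ticket; floor = certified bounds/negative ranges.

Cell pub-namedobj (venture DiscreteObjects), target (H), hadamard gen 22.  `Order167WilliamsonSymmetric668` proved: (∃ H(668) with
a signed automorphism `σ` of order `167`, an index-4 centraliser and an automorphism inverting `σ`) ⇔ (∃ `A : V₄ → ℤ/167 → ℤ`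
with SYMMETRIC blocks whose `θ_W`-array `[θ_W(g,h) · A_{g+h}(t − s)]` is Hadamard).  Here the right-hand side is identified
with the published object:
* `v4_sum`, `isHadamard_submatrix_equiv`, `v4_fin4_injective` (tools); `wMatrix_circulant_entries` (the sixteen blocks of the
  Literature matrix `wMatrix (circulant a) (circulant b) (circulant c) (circulant d)`, definitional); **`thetaWArray_eq_wMatrix`**:
  for symmetric blocks the `θ_W`-array IS Williamson's array (`0 ↦ a, (1,0) ↦ b, (0,1) ↦ c, (1,1) ↦ d`), re-indexed along
  `V₄ → Fin 4`.
* `exists_symmThetaWArray_of_wMatrix`, `williamsonSequences_of_symmThetaWArray`, **`symmThetaWArray_iff_williamsonSequences`**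
  (any `n`): (∃ symmetric `A` with the `θ_W`-array Hadamard) ⇔ (∃ WILLIAMSON SEQUENCES: four symmetric `±1` sequences
  `a, b, c, d : ℤ/n → ℤ` with `PAF_a(s) + PAF_b(s) + PAF_c(s) + PAF_d(s) = 0` for all `s ≠ 0`) [⇒: the entries of row `(0, 0)`
  are `±1`, and orthogonality of the rows `(0,0)`, `(0,s)` is the PAF identity; ⇐: `williamson_isHadamard` (Williamson 1944,
  Literature) and the re-indexing].
* **`hadamard668_normalizer_index_eight_iff_williamsonSequences`**: **(∃ H(668) with |N(⟨σ₁₆₇⟩) : ±⟨σ₁₆₇⟩| = 8 — index-4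
  centraliser and an inverting automorphism) ⇔ (∃ Williamson sequences of length 167)**;
  **`hadamard668_normalizer_index_eight_iff_williamsonMatrix`**: ⇔ (∃ symmetric `±1` sequences `a, b, c, d` on `ℤ/167` whose
  Williamson matrix `wMatrix (circulant a) (circulant b) (circulant c) (circulant d)` — Williamson 1944, Literature — is a
  Hadamard matrix, of order `4 · 167 = 668`).
DICTIONARY.  Williamson sequences are enumerated in print for every odd length `≤ 59` (Holzmann–Kharaghani–Tayfeh-Rezaie 2008:
none for 35, 47, 53, 59; table reprinted in Kharaghani–Mohammadian–Tayfeh-Rezaie 2026) and even length `≤ 70`; length `167` is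
OPEN (no finite negative formulation in print; no Williamson matrix of order 668 known).  H(668) untouched; no order excluded;
HITS 0/4.  Ours (the ⇐ half of the small iff is Williamson's theorem, Literature); no `sorry`, no definitions, default heartbeats.
-/

namespace Summit.Ventures.DiscreteObjects.Hadamard

open Finset BigOperators Matrix

open Literature.Combinatorics.Designs.GoethalsSeidel (IsHadamardMatrix)
open Literature.Combinatorics.Designs.LegendrePairs (PAF IsPM)
open Literature.Combinatorics.Designs.Williamson (wMatrix wBlocks williamson_isHadamard)

/-! ### tools -/

/-- a sum over `V₄ = ℤ/2 × ℤ/2` is the sum of the four values -/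
lemma v4_sum {β : Type*} [AddCommMonoid β] (f : ZMod 2 × ZMod 2 → β) :
    ∑ g, f g = f (0, 0) + f (1, 0) + f (0, 1) + f (1, 1) := by
  have hu : (univ : Finset (ZMod 2 × ZMod 2)) = {(0, 0), (1, 0), (0, 1), (1, 1)} := by decide
  rw [hu, Finset.sum_insert (by decide), Finset.sum_insert (by decide), Finset.sum_pair (by decide)]
  simp only [add_assoc]

/-- a Hadamard matrix re-indexed along an equivalence is a Hadamard matrix -/
lemma isHadamard_submatrix_equiv {ι κ : Type*} [Fintype ι] [DecidableEq ι] [Fintype κ] [DecidableEq κ]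
    {M : Matrix ι ι ℤ} (hM : IsHadamardMatrix M) (e : κ ≃ ι) : IsHadamardMatrix (M.submatrix e e) := by
  refine ⟨fun a b => hM.1 _ _, ?_⟩
  rw [Matrix.transpose_submatrix, Matrix.submatrix_mul_equiv, hM.2, Fintype.card_congr e]
  ext a b
  rw [Matrix.submatrix_apply, Matrix.smul_apply, Matrix.one_apply, Matrix.smul_apply, Matrix.one_apply]
  simp only [EmbeddingLike.apply_eq_iff_eq]

/-- the labelling `V₄ → Fin 4` (`0 ↦ 0`, `(1,0) ↦ 1`, `(0,1) ↦ 2`, `(1,1) ↦ 3`) is injective -/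
lemma v4_fin4_injective : Function.Injective (fun g : ZMod 2 × ZMod 2 =>
    (if g = 0 then (0 : Fin 4) else if g = (1, 0) then 1 else if g = (0, 1) then 2 else 3)) := by
  decide

section anyorder
variable {n : ℕ}

/-- the sixteen blocks of Williamson's array (Literature `wMatrix`) on circulants, entrywise (definitional) -/
lemma wMatrix_circulant_entries (a b c d : ZMod n → ℤ) (s t : ZMod n) :
    (wMatrix (circulant a) (circulant b) (circulant c) (circulant d) (0, s) (0, t) = a (s - t) ∧
    wMatrix (circulant a) (circulant b) (circulant c) (circulant d) (0, s) (1, t) = b (s - t) ∧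
    wMatrix (circulant a) (circulant b) (circulant c) (circulant d) (0, s) (2, t) = c (s - t) ∧
    wMatrix (circulant a) (circulant b) (circulant c) (circulant d) (0, s) (3, t) = d (s - t)) ∧
    (wMatrix (circulant a) (circulant b) (circulant c) (circulant d) (1, s) (0, t) = -b (s - t) ∧
    wMatrix (circulant a) (circulant b) (circulant c) (circulant d) (1, s) (1, t) = a (s - t) ∧
    wMatrix (circulant a) (circulant b) (circulant c) (circulant d) (1, s) (2, t) = -d (s - t) ∧
    wMatrix (circulant a) (circulant b) (circulant c) (circulant d) (1, s) (3, t) = c (s - t)) ∧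
    (wMatrix (circulant a) (circulant b) (circulant c) (circulant d) (2, s) (0, t) = -c (s - t) ∧
    wMatrix (circulant a) (circulant b) (circulant c) (circulant d) (2, s) (1, t) = d (s - t) ∧
    wMatrix (circulant a) (circulant b) (circulant c) (circulant d) (2, s) (2, t) = a (s - t) ∧
    wMatrix (circulant a) (circulant b) (circulant c) (circulant d) (2, s) (3, t) = -b (s - t)) ∧
    (wMatrix (circulant a) (circulant b) (circulant c) (circulant d) (3, s) (0, t) = -d (s - t) ∧
    wMatrix (circulant a) (circulant b) (circulant c) (circulant d) (3, s) (1, t) = -c (s - t) ∧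
    wMatrix (circulant a) (circulant b) (circulant c) (circulant d) (3, s) (2, t) = b (s - t) ∧
    wMatrix (circulant a) (circulant b) (circulant c) (circulant d) (3, s) (3, t) = a (s - t)) :=
  ⟨⟨rfl, rfl, rfl, rfl⟩, ⟨rfl, rfl, rfl, rfl⟩, ⟨rfl, rfl, rfl, rfl⟩, ⟨rfl, rfl, rfl, rfl⟩⟩

/-- **the `θ_W`-array with symmetric blocks is Williamson's array** (entrywise, along the labelling `V₄ → Fin 4`) -/
theorem thetaWArray_eq_wMatrix (A : ZMod 2 × ZMod 2 → ZMod n → ℤ) (hsym : ∀ k r, A k (-r) = A k r)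
    (a b : (ZMod 2 × ZMod 2) × ZMod n) :
    (if a.1 = 0 then (1 : ℤ) else if a.1 = (1, 0) then (if b.1.1 = 1 then 1 else -1)
        else if a.1 = (0, 1) then (if b.1.1 = b.1.2 then -1 else 1) else (if b.1.2 = 1 then 1 else -1)) *
      A (a.1 + b.1) (b.2 - a.2) =
    wMatrix (circulant (A (0, 0))) (circulant (A (1, 0))) (circulant (A (0, 1))) (circulant (A (1, 1)))
      ((if a.1 = 0 then (0 : Fin 4) else if a.1 = (1, 0) then 1 else if a.1 = (0, 1) then 2 else 3), a.2)
      ((if b.1 = 0 then (0 : Fin 4) else if b.1 = (1, 0) then 1 else if b.1 = (0, 1) then 2 else 3), b.2) := by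
  obtain ⟨g, s⟩ := a
  obtain ⟨h, t⟩ := b
  obtain ⟨⟨e00, e01, e02, e03⟩, ⟨e10, e11, e12, e13⟩, ⟨e20, e21, e22, e23⟩, ⟨e30, e31, e32, e33⟩⟩ :=
    wMatrix_circulant_entries (A (0, 0)) (A (1, 0)) (A (0, 1)) (A (1, 1)) s t
  have hst : ∀ k, A k (t - s) = A k (s - t) := fun k => by rw [← neg_sub, hsym]
  have s1 : ((1, 0) : ZMod 2 × ZMod 2) + (1, 0) = (0, 0) := by decide
  have s2 : ((1, 0) : ZMod 2 × ZMod 2) + (0, 1) = (1, 1) := by decide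
  have s3 : ((1, 0) : ZMod 2 × ZMod 2) + (1, 1) = (0, 1) := by decide
  have s4 : ((0, 1) : ZMod 2 × ZMod 2) + (1, 0) = (1, 1) := by decide
  have s5 : ((0, 1) : ZMod 2 × ZMod 2) + (0, 1) = (0, 0) := by decide
  have s6 : ((0, 1) : ZMod 2 × ZMod 2) + (1, 1) = (1, 0) := by decide
  have s7 : ((1, 1) : ZMod 2 × ZMod 2) + (1, 0) = (0, 1) := by decide
  have s8 : ((1, 1) : ZMod 2 × ZMod 2) + (0, 1) = (1, 0) := by decide
  have s9 : ((1, 1) : ZMod 2 × ZMod 2) + (1, 1) = (0, 0) := by decide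
  have s10 : ((0, 0) : ZMod 2 × ZMod 2) + (0, 0) = (0, 0) := by decide
  have s11 : ((0, 0) : ZMod 2 × ZMod 2) + (1, 0) = (1, 0) := by decide
  have s12 : ((0, 0) : ZMod 2 × ZMod 2) + (0, 1) = (0, 1) := by decide
  have s13 : ((0, 0) : ZMod 2 × ZMod 2) + (1, 1) = (1, 1) := by decide
  have s14 : ((1, 0) : ZMod 2 × ZMod 2) + (0, 0) = (1, 0) := by decide
  have s15 : ((0, 1) : ZMod 2 × ZMod 2) + (0, 0) = (0, 1) := by decide
  have s16 : ((1, 1) : ZMod 2 × ZMod 2) + (0, 0) = (1, 1) := by decide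
  have t0 : (0 : ZMod 2 × ZMod 2) = (0, 0) := rfl
  have t1 : ((1, 0) : ZMod 2 × ZMod 2) ≠ (0, 0) := by decide
  have t2 : ((0, 1) : ZMod 2 × ZMod 2) ≠ (0, 0) := by decide
  have t3 : ((1, 1) : ZMod 2 × ZMod 2) ≠ (0, 0) := by decide
  have t4 : ((0, 1) : ZMod 2 × ZMod 2) ≠ (1, 0) := by decide
  have t5 : ((1, 1) : ZMod 2 × ZMod 2) ≠ (1, 0) := by decide
  have t6 : ((1, 1) : ZMod 2 × ZMod 2) ≠ (0, 1) := by decide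
  have t7 : ((1, 0) : ZMod 2 × ZMod 2) ≠ (0, 1) := by decide
  have z01 : (0 : ZMod 2) ≠ 1 := by decide
  have z10 : (1 : ZMod 2) ≠ 0 := by decide
  simp only [t0]
  rcases v4_cases g with rfl | rfl | rfl | rfl <;> rcases v4_cases h with rfl | rfl | rfl | rfl <;>
    simp only [s1, s2, s3, s4, s5, s6, s7, s8, s9, s10, s11, s12, s13, s14, s15, s16, t1, t2, t3, t4, t5, t6, t7,
      z01, z10, if_true, if_false, one_mul, neg_mul, e00, e01, e02, e03, e10, e11, e12, e13, e20, e21, e22, e23, e30,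
      e31, e32, e33, hst]

/-- a Williamson matrix with symmetric circulant blocks (Literature form) gives a symmetric `θ_W`-array -/
theorem exists_symmThetaWArray_of_wMatrix [NeZero n] (a b c d : ZMod n → ℤ) (sa : ∀ i, a (-i) = a i)
    (sb : ∀ i, b (-i) = b i) (sc : ∀ i, c (-i) = c i) (sd : ∀ i, d (-i) = d i)
    (hWm : IsHadamardMatrix (wMatrix (circulant a) (circulant b) (circulant c) (circulant d))) :
    ∃ A : ZMod 2 × ZMod 2 → ZMod n → ℤ, (∀ k r, A k (-r) = A k r) ∧ A (0, 0) = a ∧ A (1, 0) = b ∧ A (0, 1) = c ∧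
      A (1, 1) = d ∧
      IsHadamardMatrix (Matrix.of fun (a' b' : (ZMod 2 × ZMod 2) × ZMod n) =>
        (if a'.1 = 0 then (1 : ℤ) else if a'.1 = (1, 0) then (if b'.1.1 = 1 then 1 else -1)
          else if a'.1 = (0, 1) then (if b'.1.1 = b'.1.2 then -1 else 1) else (if b'.1.2 = 1 then 1 else -1)) *
        A (a'.1 + b'.1) (b'.2 - a'.2)) := by
  set A : ZMod 2 × ZMod 2 → ZMod n → ℤ := fun k =>
    if k.1 = 0 then (if k.2 = 0 then a else c) else (if k.2 = 0 then b else d) with hA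
  have hsym : ∀ k r, A k (-r) = A k r := by
    intro k r
    simp only [hA]
    split_ifs
    exacts [sa r, sc r, sb r, sd r]
  have z10 : (1 : ZMod 2) ≠ 0 := by decide
  have hA0 : A (0, 0) = a := by simp [hA]
  have hA1 : A (1, 0) = b := by simp [hA, z10]
  have hA2 : A (0, 1) = c := by simp [hA, z10]
  have hA3 : A (1, 1) = d := by simp [hA, z10]
  refine ⟨A, hsym, hA0, hA1, hA2, hA3, ?_⟩
  -- the θ_W-array of A is Williamson's matrix re-indexed along V₄ × ℤ/n ≃ Fin 4 × ℤ/n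
  let f : (ZMod 2 × ZMod 2) × ZMod n → Fin 4 × ZMod n := fun x =>
    ((if x.1 = 0 then (0 : Fin 4) else if x.1 = (1, 0) then 1 else if x.1 = (0, 1) then 2 else 3), x.2)
  have hf : Function.Bijective f := by
    rw [Fintype.bijective_iff_injective_and_card]
    refine ⟨?_, by simp [ZMod.card]⟩
    rintro ⟨g, s⟩ ⟨h, t⟩ hgh
    simp only [f, Prod.mk.injEq] at hgh
    obtain ⟨h1, rfl⟩ := hgh
    rw [v4_fin4_injective h1]
  have heq : (Matrix.of fun (a' b' : (ZMod 2 × ZMod 2) × ZMod n) =>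
      (if a'.1 = 0 then (1 : ℤ) else if a'.1 = (1, 0) then (if b'.1.1 = 1 then 1 else -1)
        else if a'.1 = (0, 1) then (if b'.1.1 = b'.1.2 then -1 else 1) else (if b'.1.2 = 1 then 1 else -1)) *
      A (a'.1 + b'.1) (b'.2 - a'.2)) =
      (wMatrix (circulant a) (circulant b) (circulant c) (circulant d)).submatrix (Equiv.ofBijective f hf)
        (Equiv.ofBijective f hf) := by
    ext a' b'
    rw [Matrix.of_apply, Matrix.submatrix_apply, Equiv.ofBijective_apply, Equiv.ofBijective_apply,
      thetaWArray_eq_wMatrix A hsym a' b', hA0, hA1, hA2, hA3]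
  rw [heq]
  exact isHadamard_submatrix_equiv hWm _

/-- a symmetric Hadamard `θ_W`-array gives Williamson sequences: `±1` entries and vanishing autocorrelation sum -/
theorem williamsonSequences_of_symmThetaWArray [NeZero n] (A : ZMod 2 × ZMod 2 → ZMod n → ℤ)
    (hW : IsHadamardMatrix (Matrix.of fun (a b : (ZMod 2 × ZMod 2) × ZMod n) =>
        (if a.1 = 0 then (1 : ℤ) else if a.1 = (1, 0) then (if b.1.1 = 1 then 1 else -1)
          else if a.1 = (0, 1) then (if b.1.1 = b.1.2 then -1 else 1) else (if b.1.2 = 1 then 1 else -1)) *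
        A (a.1 + b.1) (b.2 - a.2))) :
    (∀ k, IsPM (A k)) ∧ ∀ s : ZMod n, s ≠ 0 → PAF (A (0, 0)) s + PAF (A (1, 0)) s + PAF (A (0, 1)) s + PAF (A (1, 1)) s = 0 := by
  constructor
  · intro k r
    have h := hW.1 ((0 : ZMod 2 × ZMod 2), (0 : ZMod n)) (k, r)
    simp only [Matrix.of_apply, if_true, one_mul, zero_add, sub_zero] at h
    exact h
  · intro s hs
    have hne : (((0 : ZMod 2 × ZMod 2), (0 : ZMod n)) : (ZMod 2 × ZMod 2) × ZMod n) ≠ ((0 : ZMod 2 × ZMod 2), s) := by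
      intro h; exact hs (Prod.mk.inj h).2.symm
    have h := congrFun (congrFun hW.2 ((0 : ZMod 2 × ZMod 2), (0 : ZMod n))) ((0 : ZMod 2 × ZMod 2), s)
    rw [Matrix.mul_apply, Matrix.smul_apply, Matrix.one_apply, if_neg hne, smul_zero] at h
    simp only [Matrix.transpose_apply, Matrix.of_apply, if_true, one_mul, zero_add, sub_zero] at h
    have hpaf : ∀ k, ∑ t : ZMod n, A k t * A k (t - s) = PAF (A k) s := by
      intro k
      unfold PAF
      refine Fintype.sum_equiv (Equiv.subRight s) _ _ (fun t => ?_)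
      rw [Equiv.subRight_apply, sub_add_cancel, mul_comm]
    rw [Fintype.sum_prod_type, v4_sum] at h
    simp only [hpaf] at h
    linarith

/-- **symmetric Hadamard `θ_W`-array ⇔ Williamson sequences** (any order `n`). -/
theorem symmThetaWArray_iff_williamsonSequences [NeZero n] :
    (∃ A : ZMod 2 × ZMod 2 → ZMod n → ℤ, (∀ k r, A k (-r) = A k r) ∧
      IsHadamardMatrix (Matrix.of fun (a b : (ZMod 2 × ZMod 2) × ZMod n) =>
        (if a.1 = 0 then (1 : ℤ) else if a.1 = (1, 0) then (if b.1.1 = 1 then 1 else -1)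
          else if a.1 = (0, 1) then (if b.1.1 = b.1.2 then -1 else 1) else (if b.1.2 = 1 then 1 else -1)) *
        A (a.1 + b.1) (b.2 - a.2))) ↔
    ∃ a b c d : ZMod n → ℤ, IsPM a ∧ IsPM b ∧ IsPM c ∧ IsPM d ∧ (∀ i, a (-i) = a i) ∧ (∀ i, b (-i) = b i) ∧
      (∀ i, c (-i) = c i) ∧ (∀ i, d (-i) = d i) ∧ ∀ s : ZMod n, s ≠ 0 → PAF a s + PAF b s + PAF c s + PAF d s = 0 := by
  constructor
  · rintro ⟨A, hsym, hW⟩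
    obtain ⟨hpm, hpaf⟩ := williamsonSequences_of_symmThetaWArray A hW
    exact ⟨A (0, 0), A (1, 0), A (0, 1), A (1, 1), hpm _, hpm _, hpm _, hpm _, hsym _, hsym _, hsym _, hsym _, hpaf⟩
  · rintro ⟨a, b, c, d, ha, hb, hc, hd, sa, sb, sc, sd, hs⟩
    obtain ⟨A, hsym, -, -, -, -, hW⟩ :=
      exists_symmThetaWArray_of_wMatrix a b c d sa sb sc sd (williamson_isHadamard a b c d ha hb hc hd sa sb sc sd hs)
    exact ⟨A, hsym, hW⟩

end anyorder

/-! ### H(668): the automorphism iff in Williamson's language -/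

/-- **(∃ H(668) with |N(⟨σ₁₆₇⟩) : ±⟨σ₁₆₇⟩| = 8) ⇔ (∃ Williamson sequences of length 167)**: four symmetric `±1` sequences
`a, b, c, d` on `ℤ/167` with vanishing periodic autocorrelation sum. -/
theorem hadamard668_normalizer_index_eight_iff_williamsonSequences :
    (∃ (ι : Type) (_ : Fintype ι) (_ : DecidableEq ι) (H : Matrix ι ι ℤ) (π κ π₁ κ₁ π₂ κ₂ π' κ' : Equiv.Perm ι)
        (d e d₁ e₁ d₂ e₂ d' e' : ι → ℤ) (μ : ℕ), Fintype.card ι = 668 ∧ IsHadamardMatrix H ∧ IsSignedAut H π κ d e ∧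
        π ^ 167 = 1 ∧ κ ^ 167 = 1 ∧ (π ≠ 1 ∨ κ ≠ 1) ∧ IsSignedAut H π₁ κ₁ d₁ e₁ ∧ IsSignedAut H π₂ κ₂ d₂ e₂ ∧
        Commute π₁ π ∧ Commute κ₁ κ ∧ Commute π₂ π ∧ Commute κ₂ κ ∧ π₁ ^ 2 = 1 ∧ κ₁ ^ 2 = 1 ∧ π₂ ^ 2 = 1 ∧ κ₂ ^ 2 = 1 ∧
        (π₁ ≠ 1 ∨ κ₁ ≠ 1) ∧ (π₂ ≠ 1 ∨ κ₂ ≠ 1) ∧ (π₁ ≠ π₂ ∨ κ₁ ≠ κ₂) ∧ IsSignedAut H π' κ' d' e' ∧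
        π' * π = π ^ μ * π' ∧ κ' * κ = κ ^ μ * κ' ∧ μ % 167 = 166) ↔
    ∃ a b c d : ZMod 167 → ℤ, IsPM a ∧ IsPM b ∧ IsPM c ∧ IsPM d ∧ (∀ i, a (-i) = a i) ∧ (∀ i, b (-i) = b i) ∧
      (∀ i, c (-i) = c i) ∧ (∀ i, d (-i) = d i) ∧
      ∀ s : ZMod 167, s ≠ 0 → PAF a s + PAF b s + PAF c s + PAF d s = 0 :=
  hadamard668_normalizer_index_eight_iff_williamson.trans symmThetaWArray_iff_williamsonSequences

/-- **… ⇔ (∃ a Williamson matrix of order 668 in the sense of Williamson 1944)**: symmetric `±1` sequences `a, b, c, d` on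
`ℤ/167` whose Williamson array `wMatrix (circulant a) (circulant b) (circulant c) (circulant d)` (Literature) is a Hadamard
matrix (of order `4 · 167 = 668`). -/
theorem hadamard668_normalizer_index_eight_iff_williamsonMatrix :
    (∃ (ι : Type) (_ : Fintype ι) (_ : DecidableEq ι) (H : Matrix ι ι ℤ) (π κ π₁ κ₁ π₂ κ₂ π' κ' : Equiv.Perm ι)
        (d e d₁ e₁ d₂ e₂ d' e' : ι → ℤ) (μ : ℕ), Fintype.card ι = 668 ∧ IsHadamardMatrix H ∧ IsSignedAut H π κ d e ∧
        π ^ 167 = 1 ∧ κ ^ 167 = 1 ∧ (π ≠ 1 ∨ κ ≠ 1) ∧ IsSignedAut H π₁ κ₁ d₁ e₁ ∧ IsSignedAut H π₂ κ₂ d₂ e₂ ∧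
        Commute π₁ π ∧ Commute κ₁ κ ∧ Commute π₂ π ∧ Commute κ₂ κ ∧ π₁ ^ 2 = 1 ∧ κ₁ ^ 2 = 1 ∧ π₂ ^ 2 = 1 ∧ κ₂ ^ 2 = 1 ∧
        (π₁ ≠ 1 ∨ κ₁ ≠ 1) ∧ (π₂ ≠ 1 ∨ κ₂ ≠ 1) ∧ (π₁ ≠ π₂ ∨ κ₁ ≠ κ₂) ∧ IsSignedAut H π' κ' d' e' ∧
        π' * π = π ^ μ * π' ∧ κ' * κ = κ ^ μ * κ' ∧ μ % 167 = 166) ↔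
    ∃ a b c d : ZMod 167 → ℤ, IsPM a ∧ IsPM b ∧ IsPM c ∧ IsPM d ∧ (∀ i, a (-i) = a i) ∧ (∀ i, b (-i) = b i) ∧
      (∀ i, c (-i) = c i) ∧ (∀ i, d (-i) = d i) ∧
      IsHadamardMatrix (wMatrix (circulant a) (circulant b) (circulant c) (circulant d)) := by
  rw [hadamard668_normalizer_index_eight_iff_williamson]
  constructor
  · rintro ⟨A, hsym, hW⟩
    obtain ⟨hpm, hpaf⟩ := williamsonSequences_of_symmThetaWArray A hW
    exact ⟨A (0, 0), A (1, 0), A (0, 1), A (1, 1), hpm _, hpm _, hpm _, hpm _, hsym _, hsym _, hsym _, hsym _,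
      williamson_isHadamard _ _ _ _ (hpm _) (hpm _) (hpm _) (hpm _) (hsym _) (hsym _) (hsym _) (hsym _) hpaf⟩
  · rintro ⟨a, b, c, d, -, -, -, -, sa, sb, sc, sd, hWm⟩
    obtain ⟨A, hsym, -, -, -, -, hW⟩ := exists_symmThetaWArray_of_wMatrix a b c d sa sb sc sd hWm
    exact ⟨A, hsym, hW⟩

end Summit.Ventures.DiscreteObjects.Hadamard
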